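import Summits.Ventures.PackingBounds.Configurations.DiploSimplexUnique
import Summits.Ventures.PackingBounds.Configurations.DiploSimplexEnergy

/-!
# The diplo-simplex is universally optimal among ANTIPODAL configurations — every dimension `n ≥ 3`

Framing: lottery ticket; floor = certified bounds/negative ranges. Venture `PackingBounds` (cell `pub-packcert`,
seat `pub-packcert-energy`, gen 26) — the classical "projective" half of the diplo-simplex story, for all `n`
at once, as a kernel theorem; the cell's exact three-point certificates (E3PT-diplo, per `(n, s)`) are what
excludes the NON-antipodal competitors.

Let `D_n ⊂ S^{n-1}` be the diplo-simplex (`±` a regular simplex, `2n + 2` points; inner products `-1` once,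
`∓1/n` `n` times each per point; `Config.DiploSimplex.exists_config`). For a potential `a` of the inner
product put `K = a(1/n) + a(-1/n)` and call `m ≥ 0` an *even supporting slope* of `a` if
`a(t) + a(-t) ≥ K + m (t² - 1/n²)` for `-1 < t < 1` (the even part of `a`, as a function of `u = t²`, lies
above its chord-free supporting line at `u₀ = 1/n²`; every absolutely monotonic `a` has one, see
`DiploSimplexAntipodalUniversal`).

**Theorem (`energy_ge`).** For `n ≥ 3` and such `a`, every antipodal configuration `C = -C` of `2n + 2` unit
vectors of `ℝⁿ` has `Σ_{x ≠ y ∈ C} a(⟪x,y⟫) ≥ (2n+2)(a(-1) + n a(-1/n) + n a(1/n)) = E_a(D_n)`; the set of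
antipodal energies has least element `E_a(D_n)` (`isLeast`).
**Rigidity (`nodeset_of_energy_le`, `isometric_of_energy_le`).** If the supporting inequality is strict off
`t² = 1/n²`, every antipodal minimiser has all inner products in `{-1, ±1/n}` and is therefore isometric to
`D_n` (node-set rigidity, `Config.DiploSimplexUnique.isometric_of_nodesets`).

Proof (the projective two-point bound of degree one, done on the sphere): pairing `y` with `-y` turns a row of
the energy into `a(-1) + ½ Σ_{y ≠ ±x} (a(t) + a(-t))`, the supporting line bounds this below by a multiple of
the row frame potential `Σ_y ⟪x,y⟫²`, and degree-2 Schoenberg positivity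
(`BachocVallentin.pairSum_gegenbauer_nonneg`, i.e. `Σ_{x,y} ⟪x,y⟫² ≥ |C|²/n`) finishes; all slack terms
vanish exactly on `D_n` (a tight frame with `|⟪x,y⟫| = 1/n` off the antipodes). This is the sphere form of
the statement that the `n + 1` lines of a regular simplex are universally optimal in `ℝP^{n-1}`
(Cohn–Kumar 2007 §8; Cohn–Woo 2012 §5.2; Conway–Sloane Ch. 9 for the code version), which the literature
quotes for the diplo-simplex (Ballinger et al. 2009, §3.4: "the unique optimal antipodal spherical code of its
size and dimension"). New here: nothing mathematically; the value is the all-`n` kernel statement with the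
rigidity rider, complementing `Config.DiploSimplex.exists_config` (attained values) and the per-`(n, s)`
three-point certificates of the cell (optimality among ALL configurations, `8 ≤ n ≤ 24`, small `s`).

## References
* H. Cohn, A. Kumar, J. Amer. Math. Soc. 20 (2007) 99–148, §8 (other compact two-point homogeneous
  spaces). [`CohnKumar2006`]
* H. Cohn, J. Woo, J. Amer. Math. Soc. 25 (2012) 929–958, §5.2. [`CohnWoo2012`]
* B. Ballinger, G. Blekherman, H. Cohn, N. Giansiracusa, E. Kelly, A. Schürmann, Experiment. Math. 18 (2009)
  257–283, §3.4. [`BallingerEtAl2009`]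
-/

noncomputable section

open Finset Literature.Analysis.SpecialFunctions Literature.Geometry.DiscreteGeometry
open scoped RealInnerProductSpace

namespace Summit.Ventures.PackingBounds.Energy.DiploSimplexAntipodal

variable {n : ℕ}

/-! ## Elementary lemmas -/

/-- `C₂^{(μ)}(t) = 2μ(μ+1) t² - μ`. [folklore] -/
private theorem gegenbauerSum_two_eval (μ t : ℝ) : gegenbauerSum μ 2 t = 2 * μ * (μ + 1) * t ^ 2 - μ := by
  simp [gegenbauerSum, gegenbauerCoeff, Finset.sum_range_succ, Finset.prod_range_succ, Nat.factorial]
  ring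

/-- **Frame-potential bound** (degree-2 Schoenberg positivity): for unit vectors of `ℝⁿ`, `n ≥ 3`,
`Σ_{x,y ∈ C} ⟪x,y⟫² ≥ |C|²/n`. [folklore] -/
theorem card_sq_div_le_sum_inner_sq (hn : 3 ≤ n) (C : Finset (EuclideanSpace ℝ (Fin n)))
    (h1 : ∀ x ∈ C, ‖x‖ = 1) :
    (C.card : ℝ) ^ 2 / n ≤ ∑ x ∈ C, ∑ y ∈ C, inner ℝ x y ^ 2 := by
  have hn3 : (3 : ℝ) ≤ n := by exact_mod_cast hn
  set μ : ℝ := ((n : ℝ) - 2) / 2 with hμ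
  have hμpos : 0 < μ := by rw [hμ]; linarith
  have hnpos : (0 : ℝ) < n := by linarith
  have hpos := BachocVallentin.pairSum_gegenbauer_nonneg hn 2 C h1
  unfold BachocVallentin.pairSum at hpos
  simp only [gegenbauerSum_two_eval] at hpos
  have hS : ∑ a ∈ C, ∑ b ∈ C, (2 * μ * (μ + 1) * inner ℝ a b ^ 2 - μ) =
      2 * μ * (μ + 1) * (∑ a ∈ C, ∑ b ∈ C, inner ℝ a b ^ 2) - μ * (C.card : ℝ) ^ 2 := by
    simp only [sum_sub_distrib, sum_const, nsmul_eq_mul, mul_sum]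
    ring
  rw [hS] at hpos
  have h2μ : 2 * μ * (μ + 1) = μ * n := by rw [hμ]; ring
  rw [h2μ] at hpos
  have hkey : 0 ≤ μ * ((n : ℝ) * (∑ a ∈ C, ∑ b ∈ C, inner ℝ a b ^ 2) - (C.card : ℝ) ^ 2) := by
    have : μ * ((n : ℝ) * (∑ a ∈ C, ∑ b ∈ C, inner ℝ a b ^ 2) - (C.card : ℝ) ^ 2) =
        μ * n * (∑ a ∈ C, ∑ b ∈ C, inner ℝ a b ^ 2) - μ * (C.card : ℝ) ^ 2 := by ring
    rw [this]; exact hpos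
  have h' := (mul_nonneg_iff_of_pos_left hμpos).mp hkey
  rw [div_le_iff₀ hnpos]
  linarith

/-- A unit vector is not its own antipode. [folklore] -/
private theorem neg_ne_self {x : EuclideanSpace ℝ (Fin n)} (hx : ‖x‖ = 1) : -x ≠ x := fun h => by
  have h2 : (2 : ℝ) • x = 0 := by rw [two_smul]; nth_rw 1 [← h]; simp
  have : x = 0 := (smul_eq_zero.mp h2).resolve_left two_ne_zero
  exact zero_ne_one (by rw [this, norm_zero] at hx; exact hx)

/-- `⟪x, -x⟫ = -1` for a unit vector. [folklore] -/
private theorem inner_self_neg {x : EuclideanSpace ℝ (Fin n)} (hx : ‖x‖ = 1) : inner ℝ x (-x) = -1 := by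
  rw [inner_neg_right, real_inner_self_eq_norm_sq, hx]; norm_num

/-- For unit vectors `y ∉ {x, -x}`: `-1 < ⟪x,y⟫ < 1`. [folklore] -/
theorem inner_mem_Ioo {x y : EuclideanSpace ℝ (Fin n)} (hx : ‖x‖ = 1) (hy : ‖y‖ = 1) (hne : y ≠ x)
    (hne' : y ≠ -x) : -1 < inner ℝ x y ∧ inner ℝ x y < 1 := by
  refine ⟨?_, (NewtonCert.inner_mem_Ico_of_norm_eq_one hx hy (Ne.symm hne)).2⟩
  have hy' : ‖-y‖ = 1 := by rw [norm_neg, hy]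
  have hxy : x ≠ -y := fun h => hne' (by rw [h, neg_neg])
  have h := (NewtonCert.inner_mem_Ico_of_norm_eq_one hx hy' hxy).2
  rw [inner_neg_right] at h
  linarith

/-! ## The deficit inequality -/

section Core

variable (hn : 3 ≤ n) (a : ℝ → ℝ) (m : ℝ) (C : Finset (EuclideanSpace ℝ (Fin n)))
  (h1 : ∀ x ∈ C, ‖x‖ = 1) (hN : C.card = 2 * n + 2) (hanti : ∀ x ∈ C, -x ∈ C)
include hn h1 hN hanti

/-- **Deficit inequality.** With `K = a(1/n) + a(-1/n)` and the per-pair deficit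
`D(t) = a(t) + a(-t) - K - m (t² - 1/n²)`, for every antipodal `(2n+2)`-configuration `C` and `m ≥ 0`:
`Σ_x Σ_{y ∈ C, y ≠ ±x} D(⟪x,y⟫) ≤ 2 (E_a(C) - (2n+2)(a(-1) + n a(-1/n) + n a(1/n)))`
(the dropped slack is `m (Σ_{x,y} ⟪x,y⟫² - |C|²/n) ≥ 0`). [cite: CohnKumar2006, §8] -/
theorem sum_deficit_le (hm : 0 ≤ m) :
    ∑ x ∈ C, ∑ y ∈ (C.erase x).erase (-x),
        (a (inner ℝ x y) + a (-inner ℝ x y) -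
          (a (1 / (n : ℝ)) + a (-1 / (n : ℝ)) + m * (inner ℝ x y ^ 2 - 1 / (n : ℝ) ^ 2))) ≤
      2 * (∑ x ∈ C, ∑ y ∈ C.erase x, a (inner ℝ x y) -
        (2 * n + 2 : ℝ) * (a (-1) + n * a (-1 / (n : ℝ)) + n * a (1 / (n : ℝ)))) := by
  classical
  have hn3 : (3 : ℝ) ≤ n := by exact_mod_cast hn
  have hnpos : (0 : ℝ) < n := by linarith
  have hn0 : (n : ℝ) ≠ 0 := hnpos.ne'
  -- per-row identity
  have hrow : ∀ x ∈ C, ∑ y ∈ (C.erase x).erase (-x),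
        (a (inner ℝ x y) + a (-inner ℝ x y) -
          (a (1 / (n : ℝ)) + a (-1 / (n : ℝ)) + m * (inner ℝ x y ^ 2 - 1 / (n : ℝ) ^ 2))) =
      2 * ∑ y ∈ C.erase x, a (inner ℝ x y) - 2 * a (-1)
        - 2 * n * (a (1 / (n : ℝ)) + a (-1 / (n : ℝ)) - m / (n : ℝ) ^ 2)
        - m * (∑ y ∈ C, inner ℝ x y ^ 2 - 2) := by
    intro x hx
    have hxn : -x ≠ x := neg_ne_self (h1 x hx)
    have hnx : -x ∈ C.erase x := mem_erase.2 ⟨hxn, hanti x hx⟩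
    set S := (C.erase x).erase (-x) with hS
    -- reflection `y ↦ -y` of `S`
    have hmemS : ∀ y ∈ S, -y ∈ S := by
      intro y hy
      rw [hS, mem_erase, mem_erase] at hy ⊢
      obtain ⟨hy1, hy2, hy3⟩ := hy
      refine ⟨fun h => hy2 (neg_injective h), fun h => hy1 ?_, hanti y hy3⟩
      rw [← h, neg_neg]
    have hrefl : ∑ y ∈ S, a (-inner ℝ x y) = ∑ y ∈ S, a (inner ℝ x y) := by
      refine sum_nbij' (fun y => -y) (fun y => -y) hmemS hmemS (fun y _ => neg_neg y)
        (fun y _ => neg_neg y) fun y _ => ?_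
      rw [inner_neg_right]
    -- `|S| = 2n`
    have hcardS : (S.card : ℝ) = 2 * n := by
      rw [hS, card_erase_of_mem hnx, card_erase_of_mem hx, hN]
      have : 2 * n + 2 - 1 - 1 = 2 * n := by omega
      rw [this]; push_cast; ring
    -- row frame potential without `y = ±x`
    have hsq : ∑ y ∈ S, inner ℝ x y ^ 2 = ∑ y ∈ C, inner ℝ x y ^ 2 - 2 := by
      rw [← add_sum_erase C _ hx, ← add_sum_erase (C.erase x) _ hnx, real_inner_self_eq_norm_sq,
        h1 x hx, inner_self_neg (h1 x hx)]
      ring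
    -- row energy split off the antipode
    have hE : ∑ y ∈ C.erase x, a (inner ℝ x y) = a (-1) + ∑ y ∈ S, a (inner ℝ x y) := by
      rw [← add_sum_erase (C.erase x) _ hnx, inner_self_neg (h1 x hx)]
    have hT1 : ∑ y ∈ S, (a (inner ℝ x y) + a (-inner ℝ x y)) = 2 * ∑ y ∈ S, a (inner ℝ x y) := by
      rw [sum_add_distrib, hrefl]; ring
    have hT2 : ∑ y ∈ S, (a (1 / (n : ℝ)) + a (-1 / (n : ℝ)) + m * (inner ℝ x y ^ 2 - 1 / (n : ℝ) ^ 2)) =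
        (S.card : ℝ) * (a (1 / (n : ℝ)) + a (-1 / (n : ℝ)) - m / (n : ℝ) ^ 2) +
          m * ∑ y ∈ S, inner ℝ x y ^ 2 := by
      rw [sum_add_distrib, sum_const, nsmul_eq_mul, ← mul_sum, mul_sub, sum_sub_distrib, sum_const,
        nsmul_eq_mul]
      ring
    rw [sum_sub_distrib, hT1, hT2, hcardS, hsq, hE]
    ring
  rw [sum_congr rfl hrow]
  simp only [sum_sub_distrib, sum_const, nsmul_eq_mul, ← mul_sum, hN]
  have hframe := card_sq_div_le_sum_inner_sq hn C h1
  rw [hN] at hframe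
  push_cast at hframe ⊢
  have hmf : m * ((2 * n + 2 : ℝ) ^ 2 / n) ≤ m * ∑ x ∈ C, ∑ y ∈ C, inner ℝ x y ^ 2 :=
    mul_le_mul_of_nonneg_left hframe hm
  have hk1 : m * ((2 * n + 2 : ℝ) ^ 2 / n) = 2 * (2 * n + 2) * m + 2 * (2 * n + 2) * (m / n) := by
    field_simp
  have hk2 : (2 * n + 2 : ℝ) * (2 * n * (a (1 / (n : ℝ)) + a (-1 / (n : ℝ)) - m / (n : ℝ) ^ 2)) =
      (2 * n + 2 : ℝ) * (2 * n) * (a (1 / (n : ℝ)) + a (-1 / (n : ℝ))) - 2 * (2 * n + 2) * (m / n) := by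
    field_simp
  rw [hk1] at hmf
  rw [hk2]
  linarith

/-- **Antipodal universal bound (supporting-line form).** `n ≥ 3`, `m ≥ 0`,
`a(t) + a(-t) ≥ a(1/n) + a(-1/n) + m (t² - 1/n²)` on `(-1,1)`: every antipodal configuration of `2n+2`
unit vectors of `ℝⁿ` has `Σ_{x ≠ y} a(⟪x,y⟫) ≥ (2n+2)(a(-1) + n a(-1/n) + n a(1/n))`, the energy of the
diplo-simplex. [cite: CohnKumar2006, §8] -/
theorem energy_ge (hm : 0 ≤ m)
    (hsupp : ∀ t : ℝ, -1 < t → t < 1 →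
      a (1 / (n : ℝ)) + a (-1 / (n : ℝ)) + m * (t ^ 2 - 1 / (n : ℝ) ^ 2) ≤ a t + a (-t)) :
    (2 * n + 2 : ℝ) * (a (-1) + n * a (-1 / (n : ℝ)) + n * a (1 / (n : ℝ))) ≤
      ∑ x ∈ C, ∑ y ∈ C.erase x, a (inner ℝ x y) := by
  have hD : 0 ≤ ∑ x ∈ C, ∑ y ∈ (C.erase x).erase (-x),
      (a (inner ℝ x y) + a (-inner ℝ x y) -
        (a (1 / (n : ℝ)) + a (-1 / (n : ℝ)) + m * (inner ℝ x y ^ 2 - 1 / (n : ℝ) ^ 2))) := by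
    refine sum_nonneg fun x hx => sum_nonneg fun y hy => ?_
    have hyC : y ∈ C := mem_of_mem_erase (mem_of_mem_erase hy)
    have hb := inner_mem_Ioo (h1 x hx) (h1 y hyC) (ne_of_mem_erase (mem_of_mem_erase hy))
      (ne_of_mem_erase hy)
    exact sub_nonneg.2 (hsupp _ hb.1 hb.2)
  have h := sum_deficit_le hn a m C h1 hN hanti hm
  linarith

/-- **Rigidity: node set.** If moreover the supporting inequality is STRICT off `t² = 1/n²`, an antipodal
`(2n+2)`-configuration whose energy does not exceed the diplo-simplex value has all pairwise inner products
in `{-1, -1/n, 1/n}`. [cite: CohnKumar2006, §8] -/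
theorem nodeset_of_energy_le (hm : 0 ≤ m)
    (hsupp : ∀ t : ℝ, -1 < t → t < 1 →
      a (1 / (n : ℝ)) + a (-1 / (n : ℝ)) + m * (t ^ 2 - 1 / (n : ℝ) ^ 2) ≤ a t + a (-t))
    (hstrict : ∀ t : ℝ, -1 < t → t < 1 → t ^ 2 ≠ 1 / (n : ℝ) ^ 2 →
      a (1 / (n : ℝ)) + a (-1 / (n : ℝ)) + m * (t ^ 2 - 1 / (n : ℝ) ^ 2) < a t + a (-t))
    (hle : ∑ x ∈ C, ∑ y ∈ C.erase x, a (inner ℝ x y) ≤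
      (2 * n + 2 : ℝ) * (a (-1) + n * a (-1 / (n : ℝ)) + n * a (1 / (n : ℝ)))) :
    ∀ x ∈ C, ∀ y ∈ C, x ≠ y →
      inner ℝ x y = -1 ∨ inner ℝ x y = -1 / (n : ℝ) ∨ inner ℝ x y = 1 / (n : ℝ) := by
  classical
  have hn3 : (3 : ℝ) ≤ n := by exact_mod_cast hn
  have hnpos : (0 : ℝ) < n := by linarith
  have hterm : ∀ x ∈ C, ∀ y ∈ (C.erase x).erase (-x), 0 ≤
      a (inner ℝ x y) + a (-inner ℝ x y) -
        (a (1 / (n : ℝ)) + a (-1 / (n : ℝ)) + m * (inner ℝ x y ^ 2 - 1 / (n : ℝ) ^ 2)) := by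
    intro x hx y hy
    have hyC : y ∈ C := mem_of_mem_erase (mem_of_mem_erase hy)
    have hb := inner_mem_Ioo (h1 x hx) (h1 y hyC) (ne_of_mem_erase (mem_of_mem_erase hy))
      (ne_of_mem_erase hy)
    exact sub_nonneg.2 (hsupp _ hb.1 hb.2)
  have hD : 0 ≤ ∑ x ∈ C, ∑ y ∈ (C.erase x).erase (-x),
      (a (inner ℝ x y) + a (-inner ℝ x y) -
        (a (1 / (n : ℝ)) + a (-1 / (n : ℝ)) + m * (inner ℝ x y ^ 2 - 1 / (n : ℝ) ^ 2))) :=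
    sum_nonneg fun x hx => sum_nonneg fun y hy => hterm x hx y hy
  have hle2 := sum_deficit_le hn a m C h1 hN hanti hm
  have hzero : ∑ x ∈ C, ∑ y ∈ (C.erase x).erase (-x),
      (a (inner ℝ x y) + a (-inner ℝ x y) -
        (a (1 / (n : ℝ)) + a (-1 / (n : ℝ)) + m * (inner ℝ x y ^ 2 - 1 / (n : ℝ) ^ 2))) = 0 :=
    le_antisymm (by linarith) hD
  intro x hx y hy hxy
  by_cases hyx : y = -x
  · exact Or.inl (by rw [hyx, inner_self_neg (h1 x hx)])
  have hyS : y ∈ (C.erase x).erase (-x) := mem_erase.2 ⟨hyx, mem_erase.2 ⟨Ne.symm hxy, hy⟩⟩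
  have hrow0 := (sum_eq_zero_iff_of_nonneg fun x hx => sum_nonneg fun y hy => hterm x hx y hy).1 hzero x hx
  have ht0 := (sum_eq_zero_iff_of_nonneg fun y hy => hterm x hx y hy).1 hrow0 y hyS
  have hb := inner_mem_Ioo (h1 x hx) (h1 y hy) (Ne.symm hxy) hyx
  have hsq : inner ℝ x y ^ 2 = 1 / (n : ℝ) ^ 2 := by
    by_contra hne
    have := hstrict _ hb.1 hb.2 hne
    linarith
  have hfac : (inner ℝ x y - 1 / (n : ℝ)) * (inner ℝ x y + 1 / (n : ℝ)) = 0 := by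
    have : (inner ℝ x y - 1 / (n : ℝ)) * (inner ℝ x y + 1 / (n : ℝ)) =
        inner ℝ x y ^ 2 - 1 / (n : ℝ) ^ 2 := by ring
    rw [this, hsq, sub_self]
  rcases mul_eq_zero.1 hfac with h | h
  · exact Or.inr (Or.inr (sub_eq_zero.1 h))
  · refine Or.inr (Or.inl ?_)
    have : inner ℝ x y = -(1 / (n : ℝ)) := eq_neg_of_add_eq_zero_left h
    rw [this, neg_div]

/-- **Rigidity: isometry.** Under the strict supporting inequality, every antipodal `(2n+2)`-configuration
of energy at most the diplo-simplex value is isometric to every node-set configuration (in particular to the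
diplo-simplex `Config.DiploSimplex.exists_config`, and any two such minimisers are isometric).
[cite: BallingerEtAl2009, §3.4] -/
theorem isometric_of_energy_le (hm : 0 ≤ m)
    (hsupp : ∀ t : ℝ, -1 < t → t < 1 →
      a (1 / (n : ℝ)) + a (-1 / (n : ℝ)) + m * (t ^ 2 - 1 / (n : ℝ) ^ 2) ≤ a t + a (-t))
    (hstrict : ∀ t : ℝ, -1 < t → t < 1 → t ^ 2 ≠ 1 / (n : ℝ) ^ 2 →
      a (1 / (n : ℝ)) + a (-1 / (n : ℝ)) + m * (t ^ 2 - 1 / (n : ℝ) ^ 2) < a t + a (-t))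
    (hle : ∑ x ∈ C, ∑ y ∈ C.erase x, a (inner ℝ x y) ≤
      (2 * n + 2 : ℝ) * (a (-1) + n * a (-1 / (n : ℝ)) + n * a (1 / (n : ℝ))))
    (X : Finset (EuclideanSpace ℝ (Fin n))) (hX1 : ∀ x ∈ X, ‖x‖ = 1) (hXcard : X.card = 2 * n + 2)
    (hXZ : ∀ x ∈ X, ∀ y ∈ X, x ≠ y →
      inner ℝ x y = -1 ∨ inner ℝ x y = -1 / (n : ℝ) ∨ inner ℝ x y = 1 / (n : ℝ)) :
    ∃ Ψ : EuclideanSpace ℝ (Fin n) ≃ₗᵢ[ℝ] EuclideanSpace ℝ (Fin n), C = X.image Ψ :=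
  Config.DiploSimplexUnique.isometric_of_nodesets hn X C hX1 hXcard hXZ h1 hN
    (nodeset_of_energy_le hn a m C h1 hN hanti hm hsupp hstrict hle)

end Core

/-- **The diplo-simplex minimises the `a`-energy among antipodal `(2n+2)`-configurations of `S^{n-1}`**,
every `n ≥ 3`, for every potential with an even supporting slope `m ≥ 0` at `1/n²`: the least antipodal
energy is `(2n+2)(a(-1) + n a(-1/n) + n a(1/n))`, attained by the diplo-simplex.
[cite: CohnKumar2006, §8] -/
theorem isLeast (hn : 3 ≤ n) (a : ℝ → ℝ) (m : ℝ) (hm : 0 ≤ m)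
    (hsupp : ∀ t : ℝ, -1 < t → t < 1 →
      a (1 / (n : ℝ)) + a (-1 / (n : ℝ)) + m * (t ^ 2 - 1 / (n : ℝ) ^ 2) ≤ a t + a (-t)) :
    _root_.IsLeast {E : ℝ | ∃ C : Finset (EuclideanSpace ℝ (Fin n)), C.card = 2 * n + 2 ∧
        (∀ x ∈ C, ‖x‖ = 1) ∧ (∀ x ∈ C, -x ∈ C) ∧ E = ∑ x ∈ C, ∑ y ∈ C.erase x, a (inner ℝ x y)}
      ((2 * n + 2 : ℝ) * (a (-1) + n * a (-1 / (n : ℝ)) + n * a (1 / (n : ℝ)))) := by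
  constructor
  · obtain ⟨C, hcard, h1, hZ, he⟩ := Config.DiploSimplex.exists_config n (by omega)
    exact ⟨C, hcard, h1, fun x hx => Config.DiploSimplexUnique.neg_mem hn C h1 hcard hZ hx, (he a).symm⟩
  · rintro E ⟨C, hcard, h1, hanti, rfl⟩
    exact energy_ge hn a m C h1 hcard hanti hm hsupp

end Summit.Ventures.PackingBounds.Energy.DiploSimplexAntipodal

end
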